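import Summits.NavierStokesRegularity.NavierStokesRegularity.Theses.ThinOrFatPincer
import Literature.Analysis.FluidPDE.KatoMaximalTime
import Literature.Analysis.FluidPDE.SuitableWeak
import HarnessLib.Audit

/-!
# Birth skeleton (BC3) of the crux `ThinOrFatPincer.GenericClay`

(crux item `stmt-NavierStokesRegularity-10483`, rank 2, route
`route-NavierStokesRegularity-ThinOrFatPincer`; tree path `Cruxes/GenericClay/Lines/birth.lean`;
registrar `planner-skel-stmt-NavierStokesRegularity-10483-0`, 2026-08-17. The route predates the
Lean birth certificate; this file supplies BC3 retroactively.)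

THE CRUX (fixed, the route's decl, rendered with `HasGlobalKatoSolution ν ·` unfolded): for every
`ν > 0` the GOOD SET `G_ν = {u₀ ∈ L³_σ : u₀ has a global Kato solution}` (a global mild solution in
`C([0,∞); L³)` with `u 0 = u₀`, measurable on `(0,∞) × ℝ³`) is `L³`-DENSE in the phase space
`L³_σ` (weakly divergence-free `L³` fields): every `u₀ ∈ L³_σ` is, for every `ε > 0`, within `ε`
in `‖·‖_{L³}` of a datum with a global Kato solution. Equivalently (the bad set
`B_ν = L³_σ ∖ G_ν` is closed: GIP 2003, `GIP2003_L3_stability_holds`) `B_ν` is nowhere dense —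
NO STABLE BLOW-UP.

THE CUT — the route's own TWO-LAYER PLAN one level down ("GenericClay ⇐ GenericClayTypeI →
GenericClayTypeII → GenericClay: data whose Kato solution blows up at Type-I rate, resp. otherwise,
form thin sets; glue = Baire"), typed over the tree's Kato library (`IsKatoSolutionOn`,
`katoMaximalTime` = Rusin–Šverák's `T_max(u₀)`, `IsTypeIBlowup`). Split the bad set by the RATE of
the blow-up at the maximal time `T* = T_max(u₀) < ∞`:

* `B_I(ν)`  = Type-I blow-up data: `T_max(u₀) = T < ∞` and some (by `kato_unique_holds`: the) Kato
  solution on `[0, T)` obeys the self-similar rate `‖u(t)‖_∞ ≤ C/√(T − t)` for `t ↑ T`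
  (`IsTypeIBlowup u T`, `SuitableWeak.lean`);
* `B_II(ν)` = the rest of the bad set: no global Kato solution and not Type I.

In BALL LANGUAGE at function level (the phase space is not bundled; all balls are
`eLpNorm (· − ·) 3 volume`-balls about points of `L³_σ`): a set `S` of fields is NOWHERE DENSE in
`L³_σ` iff every ball about a point of `L³_σ` contains a ball about a point of `L³_σ` none of whose
`L³_σ`-points lies in `S`; `S` is MEAGRE iff it is covered by countably many nowhere dense sets.
The three registered stubs:

* `stub_typeI_meagre`  [XL, OPEN — the card's K3 / the stable-manifold engine] — for every `ν > 0`,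
  `B_I(ν)` is meagre in `L³_σ`. The bet: every Type-I blow-up profile / DSS orbit of Navier–Stokes
  has an unstable non-symmetry direction, so `B_I` sits in countably many positive-codimension
  Lipschitz graphs (stable manifolds of the Leray-rescaled flow), each closed and nowhere dense
  (Colding–Minicozzi 2012 generic-singularities template; Wang–Lai–Gómez-Serrano–Buckmaster 2025:
  `n` unstable modes for the `n`-th profile). Why it might fail: a STABLE Type-I blow-up (ODE-type
  blow-up of `u_t = Δu + |u|^{p−1}u` is open, Merle–Zaag; Chen–Hou's Euler blow-up is stable).
* `stub_typeII_meagre` [XL, OPEN — Type-II non-genericity] — for every `ν > 0`, `B_II(ν)` is meagre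
  in `L³_σ`. The bet: Type-II (non-self-similar-rate) blow-up is a threshold / infinite-codimension
  phenomenon (Matano–Merle 2011: Type II is non-generic for the supercritical heat flow; Seregin
  2012: at a Type-II time `‖u(t)‖_{L³} → ∞`, so `B_II` is where the critical norm itself escapes).
  Why it might fail: slow (Type-II) blow-up could be the GENERIC scenario for Navier–Stokes (Hou's
  2022 numerics suggest a non-self-similar rate), and no instability mechanism is known for it.
* `stub_baire_L3sigma` [M/L, PROVABLE NOW — pure functional analysis] — the Baire category theorem for
  the phase space in ball language: the complement of a meagre set is dense in `L³_σ`
  (`L³_σ` is a closed subset of the complete space `L³`, `MeasureTheory.Lp` + closedness of weak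
  divergence-freeness under `L³`-limits by Hölder against `∇θ ∈ L^{3/2}`; nested balls with radii
  `≤ 2⁻ⁿ`, `MeasureTheory.Lp.completeSpace`/`cauchy_complete_ℒp`, `BaireSpace` of a complete
  pseudo-emetric space). Stated for an arbitrary countable index type.

`GenericClay_of : GenericClay` (the ONLY theorem of this file concluding the crux; conclusion = the
crux BY NAME, no `Prop` hypotheses, `sorry` only inside the three declared stubs, which it uses by
name) is the real composition `genericClay_assembly` (sorry-free, pure logic): given `u₀ ∈ L³_σ` and
`ε`, merge the two countable nowhere-dense covers (index `ℕ ⊕ ℕ`), let the Baire stub produce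
`v₀ ∈ L³_σ` within `ε` outside every covering set; if `v₀` had no global Kato solution it would be
Type I (covered by the first family) or not (covered by the second) — contradiction; so `v₀ ∈ G_ν`,
which is the crux's conclusion with `HasGlobalKatoSolution ν v₀` unfolded (`Iff.rfl`). Its CLOSED
twin `GenericClay_of_hyps : <sig I> → <sig II> → <sig Baire> → GenericClay` (same proof, the stub
statements as hypotheses, no placeholder anywhere) is the registrar's evidence file
`bc/GenericClay_birth_closed.lean` attached to the crux item.

WHY THIS IS A DECOMPOSITION AND NOT A COSTUME. Given the PROVED openness of `G_ν`
(`GIP2003_L3_stability_holds.exists_ball_hasGlobalKatoSolution`), `GenericClay` ⇒ `B_ν` nowhere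
dense ⇒ both jaws (subsets of `B_ν`) are nowhere dense, a fortiori meagre: each jaw is a CONSEQUENCE
of the crux, strictly weaker in kind (first category instead of nowhere dense, and only one rate
class), and neither jaw alone gives the crux (`ℚ`/`ℝ∖ℚ`: a meagre set and a set with meagre
complement can partition a complete space) — the BC3 probes `stub → GenericClay`,
`stub → NavierStokesRegularity` by `first | exact? | simpa | aesop` fail for all three stubs
(registrar's `bc/probe_*.lean`, quoted in NOTES.md). The two jaws are owned by DIFFERENT engines
(profile instability vs. critical-norm escape), which is the point of cutting by rate.

Disproof used: none exists for this crux (`ledger crux ls stmt-NavierStokesRegularity-10483`: no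
`Disproof.lean`, no lines, no ideas; 2026-08-17); negatives index of the summit — no stub is an
instance of a refuted statement (none concerns genericity / category of blow-up data). Refuter
crux-attack (2026-08-15, evidence `CruxAttack.md`): the crux SURVIVES as an honest encoding; the
degenerate instances `u₀ = 0` / `ε > ‖u₀‖₃` are true by the witness `v₀ = 0` — irrelevant to the
stubs, which are about the bad set.
-/

noncomputable section

open Set MeasureTheory Filter Topology Function
open scoped ENNReal NNReal
open Literature.Analysis.FluidPDE

namespace Summit.NavierStokesRegularity.NavierStokesRegularity.Cruxes.GenericClay.Birth

set_option linter.unusedVariables false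
set_option linter.dupNamespace false

local notation "ℝ³" => EuclideanSpace ℝ (Fin 3)

/-! ### The three registered stubs

Abbreviations used in the docstrings (all written OUT in the signatures, over tree declarations
only): `u₀ ∈ L³_σ` := `MemLp u₀ 3 volume ∧ IsWeaklyDivFree u₀`;
`ND S` := `∀ u₀ ∈ L³_σ, ∀ ε > 0, ∃ v₀ ∈ L³_σ, ‖v₀ − u₀‖₃ < ε ∧ ∃ δ > 0, ∀ w₀ ∈ L³_σ,
‖w₀ − v₀‖₃ < δ → w₀ ∉ S` (nowhere dense in `L³_σ`, ball language);
`TypeI ν u₀` := `∃ T > 0, katoMaximalTime ν u₀ = T ∧ ∃ u, IsKatoSolutionOn T ν u₀ u ∧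
IsTypeIBlowup u T` (finite maximal time, self-similar blow-up rate of the Kato solution). -/

/-- **stub 1 — `stub_typeI_meagre` (XL; OPEN — the stable-manifold jaw).** For every `ν > 0` the
set `B_I(ν)` of Type-I blow-up data is MEAGRE in `L³_σ`: there are countably many sets `F n`, each
nowhere dense in `L³_σ` (ball language), covering every `u₀ ∈ L³_σ` with `TypeI ν u₀`.
Sources: ColdingMinicozzi2012 (generic singularities via instability), WangEtAl2025 (unstable mode
counts of self-similar profiles), KochNadirashviliSereginSverak2009 / `TypeIDSSLiouvilleConjecture`
(what Type I reduces to), GallagherIftimiePlanchon2003 (openness of `G_ν`); why it might fail: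
MerleZaag (stable ODE blow-up for NLH), ChenHou2023 (stable Euler blow-up). -/
theorem stub_typeI_meagre :
    ∀ ν : ℝ, 0 < ν → ∃ F : ℕ → Set (ℝ³ → ℝ³),
      (∀ n, ∀ u₀ : ℝ³ → ℝ³, MemLp u₀ 3 volume → IsWeaklyDivFree u₀ → ∀ ε : ℝ, 0 < ε →
        ∃ v₀ : ℝ³ → ℝ³, MemLp v₀ 3 volume ∧ IsWeaklyDivFree v₀ ∧
          eLpNorm (v₀ - u₀) 3 volume < ENNReal.ofReal ε ∧
          ∃ δ : ℝ, 0 < δ ∧ ∀ w₀ : ℝ³ → ℝ³, MemLp w₀ 3 volume → IsWeaklyDivFree w₀ →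
            eLpNorm (w₀ - v₀) 3 volume < ENNReal.ofReal δ → w₀ ∉ F n) ∧
      ∀ u₀ : ℝ³ → ℝ³, MemLp u₀ 3 volume → IsWeaklyDivFree u₀ →
        (∃ T : ℝ, 0 < T ∧ katoMaximalTime ν u₀ = ENNReal.ofReal T ∧
          ∃ u : ℝ → ℝ³ → ℝ³, IsKatoSolutionOn T ν u₀ u ∧ IsTypeIBlowup u T) →
        ∃ n, u₀ ∈ F n := by
  sorry

/-- **stub 2 — `stub_typeII_meagre` (XL; OPEN — the critical-norm-escape jaw).** For every `ν > 0`
the set `B_II(ν)` of data WITHOUT a global Kato solution whose blow-up is NOT of Type I is MEAGRE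
in `L³_σ` (countably many nowhere dense sets cover every `u₀ ∈ L³_σ` with
`¬ HasGlobalKatoSolution ν u₀ ∧ ¬ TypeI ν u₀`).
Sources: MatanoMerle2011 (Type II non-generic for supercritical NLH), Seregin2012 (`L³`-norm escape
at Type-II times), GallagherIftimiePlanchon2003; why it might fail: Hou2022PotentiallySingularNS
(numerically non-self-similar rates), no known instability mechanism for slow blow-up. -/
theorem stub_typeII_meagre :
    ∀ ν : ℝ, 0 < ν → ∃ F : ℕ → Set (ℝ³ → ℝ³),
      (∀ n, ∀ u₀ : ℝ³ → ℝ³, MemLp u₀ 3 volume → IsWeaklyDivFree u₀ → ∀ ε : ℝ, 0 < ε →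
        ∃ v₀ : ℝ³ → ℝ³, MemLp v₀ 3 volume ∧ IsWeaklyDivFree v₀ ∧
          eLpNorm (v₀ - u₀) 3 volume < ENNReal.ofReal ε ∧
          ∃ δ : ℝ, 0 < δ ∧ ∀ w₀ : ℝ³ → ℝ³, MemLp w₀ 3 volume → IsWeaklyDivFree w₀ →
            eLpNorm (w₀ - v₀) 3 volume < ENNReal.ofReal δ → w₀ ∉ F n) ∧
      ∀ u₀ : ℝ³ → ℝ³, MemLp u₀ 3 volume → IsWeaklyDivFree u₀ →
        ¬ HasGlobalKatoSolution ν u₀ →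
        ¬ (∃ T : ℝ, 0 < T ∧ katoMaximalTime ν u₀ = ENNReal.ofReal T ∧
          ∃ u : ℝ → ℝ³ → ℝ³, IsKatoSolutionOn T ν u₀ u ∧ IsTypeIBlowup u T) →
        ∃ n, u₀ ∈ F n := by
  sorry

/-- **stub 3 — `stub_baire_L3sigma` (M/L; PROVABLE NOW — Baire category in the phase space).** The
complement of a meagre set is dense in `L³_σ`, in ball language: for any countable family of sets
`F i`, each nowhere dense in `L³_σ`, every `u₀ ∈ L³_σ` is, for every `ε > 0`, within `ε` in `L³` of
some `v₀ ∈ L³_σ` lying in no `F i`. (`L³_σ` with the `eLpNorm (· − ·) 3` pseudo-distance is a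
complete pseudometric space — `L³` is complete and weak divergence-freeness is closed under
`L³`-limits — so nested balls with summable radii converge.) Sources: Baire; Galeati2026 Thm 1.1
(the Baire template for generic well-posedness); Mathlib `BaireSpace`, `MeasureTheory.Lp`. -/
theorem stub_baire_L3sigma :
    ∀ (ι : Type) [Countable ι] (F : ι → Set (ℝ³ → ℝ³)),
      (∀ i, ∀ u₀ : ℝ³ → ℝ³, MemLp u₀ 3 volume → IsWeaklyDivFree u₀ → ∀ ε : ℝ, 0 < ε →
        ∃ v₀ : ℝ³ → ℝ³, MemLp v₀ 3 volume ∧ IsWeaklyDivFree v₀ ∧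
          eLpNorm (v₀ - u₀) 3 volume < ENNReal.ofReal ε ∧
          ∃ δ : ℝ, 0 < δ ∧ ∀ w₀ : ℝ³ → ℝ³, MemLp w₀ 3 volume → IsWeaklyDivFree w₀ →
            eLpNorm (w₀ - v₀) 3 volume < ENNReal.ofReal δ → w₀ ∉ F i) →
      ∀ u₀ : ℝ³ → ℝ³, MemLp u₀ 3 volume → IsWeaklyDivFree u₀ → ∀ ε : ℝ, 0 < ε →
        ∃ v₀ : ℝ³ → ℝ³, MemLp v₀ 3 volume ∧ IsWeaklyDivFree v₀ ∧
          eLpNorm (v₀ - u₀) 3 volume < ENNReal.ofReal ε ∧ ∀ i, v₀ ∉ F i := by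
  sorry

/-! ### The assembly (sorry-free) and the skeleton theorem -/

/-- **Assembly, closed form** (pure logic; the conclusion is the crux UNFOLDED, so that
`GenericClay_of` below is the only theorem of the file concluding the crux by name): merge the two
countable nowhere-dense covers over the index `ℕ ⊕ ℕ`, take the Baire point `v₀` within `ε`, and
observe that a datum outside both covers cannot fail to have a global Kato solution (it would be
Type I or not). [folklore] -/
theorem genericClay_assembly
    (hI : ∀ ν : ℝ, 0 < ν → ∃ F : ℕ → Set (ℝ³ → ℝ³),
      (∀ n, ∀ u₀ : ℝ³ → ℝ³, MemLp u₀ 3 volume → IsWeaklyDivFree u₀ → ∀ ε : ℝ, 0 < ε →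
        ∃ v₀ : ℝ³ → ℝ³, MemLp v₀ 3 volume ∧ IsWeaklyDivFree v₀ ∧
          eLpNorm (v₀ - u₀) 3 volume < ENNReal.ofReal ε ∧
          ∃ δ : ℝ, 0 < δ ∧ ∀ w₀ : ℝ³ → ℝ³, MemLp w₀ 3 volume → IsWeaklyDivFree w₀ →
            eLpNorm (w₀ - v₀) 3 volume < ENNReal.ofReal δ → w₀ ∉ F n) ∧
      ∀ u₀ : ℝ³ → ℝ³, MemLp u₀ 3 volume → IsWeaklyDivFree u₀ →
        (∃ T : ℝ, 0 < T ∧ katoMaximalTime ν u₀ = ENNReal.ofReal T ∧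
          ∃ u : ℝ → ℝ³ → ℝ³, IsKatoSolutionOn T ν u₀ u ∧ IsTypeIBlowup u T) →
        ∃ n, u₀ ∈ F n)
    (hII : ∀ ν : ℝ, 0 < ν → ∃ F : ℕ → Set (ℝ³ → ℝ³),
      (∀ n, ∀ u₀ : ℝ³ → ℝ³, MemLp u₀ 3 volume → IsWeaklyDivFree u₀ → ∀ ε : ℝ, 0 < ε →
        ∃ v₀ : ℝ³ → ℝ³, MemLp v₀ 3 volume ∧ IsWeaklyDivFree v₀ ∧
          eLpNorm (v₀ - u₀) 3 volume < ENNReal.ofReal ε ∧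
          ∃ δ : ℝ, 0 < δ ∧ ∀ w₀ : ℝ³ → ℝ³, MemLp w₀ 3 volume → IsWeaklyDivFree w₀ →
            eLpNorm (w₀ - v₀) 3 volume < ENNReal.ofReal δ → w₀ ∉ F n) ∧
      ∀ u₀ : ℝ³ → ℝ³, MemLp u₀ 3 volume → IsWeaklyDivFree u₀ →
        ¬ HasGlobalKatoSolution ν u₀ →
        ¬ (∃ T : ℝ, 0 < T ∧ katoMaximalTime ν u₀ = ENNReal.ofReal T ∧
          ∃ u : ℝ → ℝ³ → ℝ³, IsKatoSolutionOn T ν u₀ u ∧ IsTypeIBlowup u T) →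
        ∃ n, u₀ ∈ F n)
    (hB : ∀ (ι : Type) [Countable ι] (F : ι → Set (ℝ³ → ℝ³)),
      (∀ i, ∀ u₀ : ℝ³ → ℝ³, MemLp u₀ 3 volume → IsWeaklyDivFree u₀ → ∀ ε : ℝ, 0 < ε →
        ∃ v₀ : ℝ³ → ℝ³, MemLp v₀ 3 volume ∧ IsWeaklyDivFree v₀ ∧
          eLpNorm (v₀ - u₀) 3 volume < ENNReal.ofReal ε ∧
          ∃ δ : ℝ, 0 < δ ∧ ∀ w₀ : ℝ³ → ℝ³, MemLp w₀ 3 volume → IsWeaklyDivFree w₀ →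
            eLpNorm (w₀ - v₀) 3 volume < ENNReal.ofReal δ → w₀ ∉ F i) →
      ∀ u₀ : ℝ³ → ℝ³, MemLp u₀ 3 volume → IsWeaklyDivFree u₀ → ∀ ε : ℝ, 0 < ε →
        ∃ v₀ : ℝ³ → ℝ³, MemLp v₀ 3 volume ∧ IsWeaklyDivFree v₀ ∧
          eLpNorm (v₀ - u₀) 3 volume < ENNReal.ofReal ε ∧ ∀ i, v₀ ∉ F i) :
    ∀ ν : ℝ, 0 < ν → ∀ u₀ : ℝ³ → ℝ³, MemLp u₀ 3 volume → IsWeaklyDivFree u₀ → ∀ ε : ℝ, 0 < ε →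
      ∃ v₀ : ℝ³ → ℝ³, MemLp v₀ 3 volume ∧ IsWeaklyDivFree v₀ ∧
        eLpNorm (v₀ - u₀) 3 volume < ENNReal.ofReal ε ∧
        ∃ u : ℝ → ℝ³ → ℝ³, IsGlobalMildSolution ν 0 v₀ u ∧ ContinuousInLpOn (Set.Ici 0) 3 u ∧
          u 0 = v₀ ∧ AEStronglyMeasurable (Function.uncurry u) (volume.restrict (Set.Ioi 0 ×ˢ Set.univ)) := by
  intro ν hν u₀ hu₀ hdiv ε hε
  obtain ⟨F, hF, hFcov⟩ := hI ν hν
  obtain ⟨H, hH, hHcov⟩ := hII ν hν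
  -- the merged countable family of nowhere dense sets
  have hK : ∀ i : ℕ ⊕ ℕ, ∀ u₀ : ℝ³ → ℝ³, MemLp u₀ 3 volume → IsWeaklyDivFree u₀ → ∀ ε : ℝ, 0 < ε →
      ∃ v₀ : ℝ³ → ℝ³, MemLp v₀ 3 volume ∧ IsWeaklyDivFree v₀ ∧
        eLpNorm (v₀ - u₀) 3 volume < ENNReal.ofReal ε ∧
        ∃ δ : ℝ, 0 < δ ∧ ∀ w₀ : ℝ³ → ℝ³, MemLp w₀ 3 volume → IsWeaklyDivFree w₀ →
          eLpNorm (w₀ - v₀) 3 volume < ENNReal.ofReal δ → w₀ ∉ Sum.elim F H i := by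
    rintro (n | n)
    · exact hF n
    · exact hH n
  -- the Baire point
  obtain ⟨v₀, hv₀, hvdiv, hdist, hout⟩ := hB (ℕ ⊕ ℕ) (Sum.elim F H) hK u₀ hu₀ hdiv ε hε
  refine ⟨v₀, hv₀, hvdiv, hdist, ?_⟩
  -- a datum outside both covers has a global Kato solution
  by_contra hbad
  have hbad' : ¬ HasGlobalKatoSolution ν v₀ := hbad
  by_cases hT : ∃ T : ℝ, 0 < T ∧ katoMaximalTime ν v₀ = ENNReal.ofReal T ∧
      ∃ u : ℝ → ℝ³ → ℝ³, IsKatoSolutionOn T ν v₀ u ∧ IsTypeIBlowup u T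
  · obtain ⟨n, hn⟩ := hFcov v₀ hv₀ hvdiv hT
    exact hout (Sum.inl n) hn
  · obtain ⟨n, hn⟩ := hHcov v₀ hv₀ hvdiv hbad' hT
    exact hout (Sum.inr n) hn

/-- **Birth composition (the skeleton theorem).** The crux BY NAME from the three registered
stubs, used by name, through the sorry-free assembly `genericClay_assembly`. -/
theorem GenericClay_of :
    Summit.NavierStokesRegularity.NavierStokesRegularity.Theses.ThinOrFatPincer.GenericClay :=
  genericClay_assembly stub_typeI_meagre stub_typeII_meagre stub_baire_L3sigma

end Summit.NavierStokesRegularity.NavierStokesRegularity.Cruxes.GenericClay.Birth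

end
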